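import Summits.BirchSwinnertonDyer.BirchSwinnertonDyer.Theorems.GenusKolyvaginAtTwoPowDvdShaCardAtTwoRTEigenIndexTwoKolyvaginPrime
import HarnessLib

/-!
# Route `GenusKolyvaginAtTwo`, crux L_T `PowDvdShaCardAtTwoRT` (stmt-BirchSwinnertonDyer-23242), LINE 18 stub KS —
# THE SOCKET `hK` OF THE KS ASSEMBLY, DISCHARGED BY NAME (eigen index law at an admissible prime)

Seat `bsd-line-gk2-p5` g24 (cell `bsd-f1-sign2`, SUPPLY lineage), `--supports stmt-BirchSwinnertonDyer-23242` (helper; closes nothing).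
THEOREMS ONLY (no definition, no named fact, no `sorry`).  BSD is NOT proved by any of this; neither is the crux nor any stub.

WHY.  gk2-p2 g19's KS assembly (`…RTRecordClauseOfDeepSwap.exists_recordLevel_avoiding_of_deepSwap`, p725584, and
`…RTKolyvaginSuppliesOfDeepSwap`, p727242) proves the registered conclusion of stub KS from the frame + Q2 + (NPh) and THREE displayed
sockets `hbot`, `hswap`, `hK`.  The third is, VERBATIM,
`∀ ℓ, (Zhang–Kolyvagin ℓ ∧ L ≤ index ℓ) ∧ G ℓ → ∀ C ≤ H¹(K, E[2^L]), (∀ c ∈ C, c Selmer ∧ τ_* c = (−w(E)·(−1)^r) • c) →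
(⨅_{v ∋ ℓ} torsionLocalKer_v).relIndex (C ⊓ H¹[2]) ∣ 2`
for the assembler's extra prime predicate `G`.  This file DISCHARGES it from gk2-p5 g23's eigen index law
`relIndex_iInf_torsionLocalKer_inf_torsionBy_two_dvd_two` (p723289) for every `G` that yields Gross's `Frob(ℓ) = Frob(∞)` on `K(E[2^L])`
— in particular for the margin-`k` predicate `G ℓ := L + k ≤ index ℓ ∧ FrobEqFrobInfty W K (2^(L+k)) ℓ` of LEAD g18's ruling (R2)
(`FrobEqFrobInfty.of_dvd`), and on `Δ < 0` for the level-2 Gross predicate `FrobEqFrobInfty W K 2 ℓ` of the drops' `adm`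
(gk2-p5 g22 `frobEqFrobInfty_two_pow_of_isKolyvaginPrime_two`).  The sign `−w(E)(−1)^r` is `±1` (`rootNumber_eq_one_or`).
* `hK_socket_of_frobEqFrobInfty` — generic `G` with `hG : … → FrobEqFrobInfty W K (2^L) ℓ`;
* `hK_socket_margin` — `G ℓ := L + k ≤ index ℓ ∧ FrobEqFrobInfty W K (2^(L+k)) ℓ`;
* `hK_socket_level` — `G ℓ := FrobEqFrobInfty W K (2^L) ℓ`;
* `hK_socket_of_frobEqFrobInfty_two` — on `Δ < 0`, `G ℓ := FrobEqFrobInfty W K 2 ℓ ∧ G' ℓ` for any `G'`.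
HONEST FRAMING: plug forms only; the mathematics is p723289's.  Closes nothing.

References: [McCallumLMS1991] §3 (3), §5 proof of Prop. 5.2; [GrossLMS1991] §3 (3.1)–(3.3), §9 Prop. 9.6; [WZhang2014] Notations (xii).
-/

set_option autoImplicit false
-- `Summit.<P>.<Sub>` repeats `BirchSwinnertonDyer` by the tree's layout convention (D-0017)
set_option linter.dupNamespace false

noncomputable section

open scoped Classical

namespace Summit.BirchSwinnertonDyer.BirchSwinnertonDyer.Theorems.GenusExact.PlusDescent

open WeierstrassCurve NumberField IsDedekindDomain Field
open Literature.NumberTheory.GaloisRepresentations Literature.NumberTheory.EllipticCurves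

variable (W : WeierstrassCurve ℚ) [W.IsElliptic] [W.IsGloballyMinimal] {K : Type} [Field K] [NumberField K]

omit [W.IsElliptic] [W.IsGloballyMinimal] in
/-- The sign `−w(E)·(−1)^r` of the depth-`r` Kolyvagin classes is `±1`. [folklore] -/
theorem neg_rootNumber_mul_neg_one_pow_eq_or (r : ℕ) :
    (-W.rootNumber * (-1) ^ r : ℤ) = 1 ∨ (-W.rootNumber * (-1) ^ r : ℤ) = -1 := by
  rcases W.rootNumber_eq_one_or with h | h <;> rcases neg_one_pow_eq_or ℤ r with h' | h' <;> simp [h, h']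

/-- **The KS assembly's socket `hK`, discharged** for every extra prime predicate `G` that yields `Frob(ℓ) = Frob(∞)` on `K(E[2^L])`
at the admissible primes: VERBATIM the binder `hK` of `PlusDescent.exists_recordLevel_avoiding_of_deepSwap` (gk2-p2 g19), from gk2-p5 g23's
`relIndex_iInf_torsionLocalKer_inf_torsionBy_two_dvd_two` (`Δ < 0`, `K` imaginary quadratic, `τ ≠ 1`, `L ≥ 1`).
[cite: McCallumLMS1991, §5 proof of Prop. 5.2] [cite: GrossLMS1991, §9 Prop. 9.6] -/
theorem hK_socket_of_frobEqFrobInfty (hΔ : W.Δ < 0) (hK : IsImaginaryQuadratic K) {τ : K ≃ₐ[ℚ] K} (hτ : τ ≠ 1)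
    {L : ℕ} (hL : 1 ≤ L) (r : ℕ) (G : ℕ → Prop)
    (hG : ∀ ℓ : ℕ, Zhang2014.IsKolyvaginPrime (W.conductorNorm ℤ) W K 2 ℓ → L ≤ Zhang2014.kolyvaginIndex W 2 ℓ → G ℓ →
      FrobEqFrobInfty W K (2 ^ L) ℓ) :
    ∀ ℓ : ℕ, (Zhang2014.IsKolyvaginPrime (W.conductorNorm ℤ) W K 2 ℓ ∧ L ≤ Zhang2014.kolyvaginIndex W 2 ℓ) ∧ G ℓ →
      ∀ C : AddSubgroup (galH1Torsion (W.baseChange K) ((2 ^ L : ℕ) : ℤ)),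
      (∀ c ∈ C, c ∈ selmerGroup (W.baseChange K) ((2 ^ L : ℕ) : ℤ) ∧
        conjAct W τ ((2 ^ L : ℕ) : ℤ) c = (-W.rootNumber * (-1) ^ r) • c) →
      (⨅ (v : HeightOneSpectrum (𝓞 K)) (_ : ((ℓ : ℕ) : 𝓞 K) ∈ v.asIdeal),
          (W.baseChange K).torsionLocalKer (v.adicCompletion K) ((2 ^ L : ℕ) : ℤ)).relIndex
        (C ⊓ AddSubgroup.torsionBy (galH1Torsion (W.baseChange K) ((2 ^ L : ℕ) : ℤ)) (2 : ℤ)) ∣ 2 := by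
  intro ℓ hℓ C hC
  haveI : Fact ℓ.Prime := ⟨hℓ.1.1.1⟩
  exact relIndex_iInf_torsionLocalKer_inf_torsionBy_two_dvd_two W hΔ hK hτ hL hℓ.1.1.2.2.2.1 hℓ.1.1.2.2.1
    (hasGoodReductionAtPrime_of_not_dvd_conductorNorm W hℓ.1.1.2.1) (hG ℓ hℓ.1.1 hℓ.1.2 hℓ.2)
    (neg_rootNumber_mul_neg_one_pow_eq_or W r) C hC

/-- **`hK` for the margin-`k` predicate** `G ℓ := L + k ≤ index ℓ ∧ FrobEqFrobInfty W K (2^(L+k)) ℓ` (LEAD g18 ruling (R2): margin one,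
`k = 1`; `FrobEqFrobInfty.of_dvd` down to `2^L`). [cite: McCallumLMS1991, §5 proof of Prop. 5.2] [cite: GrossLMS1991, §3 (3.2)] -/
theorem hK_socket_margin (hΔ : W.Δ < 0) (hK : IsImaginaryQuadratic K) {τ : K ≃ₐ[ℚ] K} (hτ : τ ≠ 1)
    {L : ℕ} (hL : 1 ≤ L) (r k : ℕ) :
    ∀ ℓ : ℕ, (Zhang2014.IsKolyvaginPrime (W.conductorNorm ℤ) W K 2 ℓ ∧ L ≤ Zhang2014.kolyvaginIndex W 2 ℓ) ∧
        (L + k ≤ Zhang2014.kolyvaginIndex W 2 ℓ ∧ FrobEqFrobInfty W K (2 ^ (L + k)) ℓ) →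
      ∀ C : AddSubgroup (galH1Torsion (W.baseChange K) ((2 ^ L : ℕ) : ℤ)),
      (∀ c ∈ C, c ∈ selmerGroup (W.baseChange K) ((2 ^ L : ℕ) : ℤ) ∧
        conjAct W τ ((2 ^ L : ℕ) : ℤ) c = (-W.rootNumber * (-1) ^ r) • c) →
      (⨅ (v : HeightOneSpectrum (𝓞 K)) (_ : ((ℓ : ℕ) : 𝓞 K) ∈ v.asIdeal),
          (W.baseChange K).torsionLocalKer (v.adicCompletion K) ((2 ^ L : ℕ) : ℤ)).relIndex
        (C ⊓ AddSubgroup.torsionBy (galH1Torsion (W.baseChange K) ((2 ^ L : ℕ) : ℤ)) (2 : ℤ)) ∣ 2 :=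
  hK_socket_of_frobEqFrobInfty W hΔ hK hτ hL r _ fun _ _ _ hGℓ ↦ hGℓ.2.of_dvd (pow_dvd_pow 2 (Nat.le_add_right L k))

/-- **`hK` for the level predicate** `G ℓ := FrobEqFrobInfty W K (2^L) ℓ` (margin zero). [cite: McCallumLMS1991, §5 proof of Prop. 5.2] -/
theorem hK_socket_level (hΔ : W.Δ < 0) (hK : IsImaginaryQuadratic K) {τ : K ≃ₐ[ℚ] K} (hτ : τ ≠ 1)
    {L : ℕ} (hL : 1 ≤ L) (r : ℕ) :
    ∀ ℓ : ℕ, (Zhang2014.IsKolyvaginPrime (W.conductorNorm ℤ) W K 2 ℓ ∧ L ≤ Zhang2014.kolyvaginIndex W 2 ℓ) ∧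
        FrobEqFrobInfty W K (2 ^ L) ℓ →
      ∀ C : AddSubgroup (galH1Torsion (W.baseChange K) ((2 ^ L : ℕ) : ℤ)),
      (∀ c ∈ C, c ∈ selmerGroup (W.baseChange K) ((2 ^ L : ℕ) : ℤ) ∧
        conjAct W τ ((2 ^ L : ℕ) : ℤ) c = (-W.rootNumber * (-1) ^ r) • c) →
      (⨅ (v : HeightOneSpectrum (𝓞 K)) (_ : ((ℓ : ℕ) : 𝓞 K) ∈ v.asIdeal),
          (W.baseChange K).torsionLocalKer (v.adicCompletion K) ((2 ^ L : ℕ) : ℤ)).relIndex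
        (C ⊓ AddSubgroup.torsionBy (galH1Torsion (W.baseChange K) ((2 ^ L : ℕ) : ℤ)) (2 : ℤ)) ∣ 2 :=
  hK_socket_of_frobEqFrobInfty W hΔ hK hτ hL r _ fun _ _ _ hGℓ ↦ hGℓ

/-- **`hK` for the level-2 Gross predicate** `G ℓ := FrobEqFrobInfty W K 2 ℓ ∧ G' ℓ` (the drops' `adm`, any `G'`): on `Δ < 0` with
`ρ_{E,2^L}` onto, the level-2 condition at a Zhang–Kolyvagin prime of index `≥ L` lifts to `2^L` (gk2-p5 g22
`GrossLevelAtTwo.frobEqFrobInfty_two_pow_of_frobEqFrobInfty_two`). [cite: McCallumLMS1991, §5 proof of Prop. 5.2] [cite: GrossLMS1991, §3 (3.2)–(3.3)] -/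
theorem hK_socket_of_frobEqFrobInfty_two (hΔ : W.Δ < 0) (hK : IsImaginaryQuadratic K)
    {τ : K ≃ₐ[ℚ] K} (hτ : τ ≠ 1) {L : ℕ} (hL : 1 ≤ L) (hsurj : W.HasSurjectiveModNGaloisRep (2 ^ L : ℕ)) (r : ℕ) (G' : ℕ → Prop) :
    ∀ ℓ : ℕ, (Zhang2014.IsKolyvaginPrime (W.conductorNorm ℤ) W K 2 ℓ ∧ L ≤ Zhang2014.kolyvaginIndex W 2 ℓ) ∧
        (FrobEqFrobInfty W K 2 ℓ ∧ G' ℓ) →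
      ∀ C : AddSubgroup (galH1Torsion (W.baseChange K) ((2 ^ L : ℕ) : ℤ)),
      (∀ c ∈ C, c ∈ selmerGroup (W.baseChange K) ((2 ^ L : ℕ) : ℤ) ∧
        conjAct W τ ((2 ^ L : ℕ) : ℤ) c = (-W.rootNumber * (-1) ^ r) • c) →
      (⨅ (v : HeightOneSpectrum (𝓞 K)) (_ : ((ℓ : ℕ) : 𝓞 K) ∈ v.asIdeal),
          (W.baseChange K).torsionLocalKer (v.adicCompletion K) ((2 ^ L : ℕ) : ℤ)).relIndex
        (C ⊓ AddSubgroup.torsionBy (galH1Torsion (W.baseChange K) ((2 ^ L : ℕ) : ℤ)) (2 : ℤ)) ∣ 2 :=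
  hK_socket_of_frobEqFrobInfty W hΔ hK hτ hL r _ fun _ hKol hidx hGℓ ↦
    GrossLevelAtTwo.frobEqFrobInfty_two_pow_of_frobEqFrobInfty_two W K hK hΔ hL hsurj hKol hidx hGℓ.1

end Summit.BirchSwinnertonDyer.BirchSwinnertonDyer.Theorems.GenusExact.PlusDescent

end
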